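import Summits.HubbardSuperconductivity.HubbardSuperconductivity.Theorems.AnisotropyChordTransferFibre3FinXDCheck
import Summits.HubbardSuperconductivity.HubbardSuperconductivity.Theorems.AnisotropyChordTransferFibre3FinXDSideZ
import Summits.HubbardSuperconductivity.HubbardSuperconductivity.Theorems.AnisotropyChordTransferFibre3FinXCCover
import Summits.HubbardSuperconductivity.HubbardSuperconductivity.Theorems.AnisotropyChordTransferFibre3KT2aRow

/-!
# Route `AnisotropyChord` / H0 rotor rung: FIN per-`L` row-D / GM₃ — the remaining DEFINITIONS (key completeness, direction summands, GM₃ cells)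

Definitions used by the soundness and glue files of the per-`L` row-D evaluator XD and of the per-`L` GM₃ assembly (kept apart so that those
files are proof-only): the key-completeness Boolean `keysOK` of the momentum lists of `…FinXDEval` (decided once: `keysOK_true`,
`xdLow_keys`; `xdLow = lowList`), the direction summands `ftwTerm` / `bdTerm` of `FTWfun` / `Bdfun`, and the GM₃ cell list machinery
`GCell` (`λ·D, aD, c, bn, la, lb`), `gmCellOK` (row-D fact `xdCellAny0`, side fact `sdCellAnyZ`, nesting, enclosing rows-N₁+C fact
`xbcCellAny`), `cellsAllG`, `cellsLastG`, `gmCheck`.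
Prover seat `hubbard-h0-rotor-p3` g7; helper for piece A = stmt-HubbardSuperconductivity-23918 of rung 19089 (`--supports`, helper class).
WHAT THIS IS NOT: nothing here proves superconductivity in the Hubbard model (rotor TARGET as worded stays FALSE, g15 verdict); definitions for
the FIN certificates of ONE conditional reduction.  Tree imports only; no sorry, no new axioms.
-/

set_option linter.dupNamespace false
set_option autoImplicit false

namespace Summit.HubbardSuperconductivity.HubbardSuperconductivity.Theorems.AnisotropyChord.Transfer.Fibre3

namespace FinXD

open scoped BigOperators
open Finset Hole2 FinCell FinXB

/-! ## Key completeness of the momentum lists (L-independent, decided once) -/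

/-- the six pair-transform momenta of a low `k`. -/
def ymoms (k : (ℤ × ℤ) × (ℤ × ℤ)) : List (ℤ × ℤ) :=
  [k.1, k.2, (k.1.1 - 1, k.1.2), (k.2.1 - 1, k.2.2), (k.1.1 + k.2.1, k.1.2 + k.2.2), (k.1.1 + k.2.1 - 1, k.1.2 + k.2.2)]

/-- the key-completeness check (Boolean, L-independent). -/
def keysOK : Bool :=
  xdLow.all fun k =>
    ((trans3 k).all fun K => decide (K ∈ keys3) && decide (K.1 ∈ keysQ) && decide (K.2 ∈ keysQ) &&
        decide ((K.1.1 + K.2.1, K.1.2 + K.2.2) ∈ keysQ)) &&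
    ((ymoms k).all fun q => decide (q ∈ keysQ) && decide ((q.2, q.1) ∈ keysQ))

/-- the check passes. [folklore] -/
theorem keysOK_true : keysOK = true := by decide

/-- every low `k` finds its `Π̂` momentum pairs in `keys3` (with their `T`-momenta in `keysQ`) and its pair-transform momenta and
their transposes in `keysQ`. [folklore] -/
theorem xdLow_keys : ∀ k ∈ xdLow,
    (∀ K ∈ trans3 k, K ∈ keys3 ∧ K.1 ∈ keysQ ∧ K.2 ∈ keysQ ∧ (K.1.1 + K.2.1, K.1.2 + K.2.2) ∈ keysQ) ∧
    (∀ q ∈ ymoms k, q ∈ keysQ ∧ (q.2, q.1) ∈ keysQ) := by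
  have h := keysOK_true
  unfold keysOK at h
  rw [List.all_eq_true] at h
  intro k hk
  have hk' := h k hk
  rw [Bool.and_eq_true, List.all_eq_true, List.all_eq_true] at hk'
  obtain ⟨h1, h2⟩ := hk'
  constructor
  · intro K hK
    have := h1 K hK
    simp only [Bool.and_eq_true, decide_eq_true_eq] at this
    exact ⟨this.1.1.1, this.1.1.2, this.1.2, this.2⟩
  · intro q hq
    have := h2 q hq
    simp only [Bool.and_eq_true, decide_eq_true_eq] at this
    exact this

/-- `xdLow` is `lowList`. [folklore] -/
theorem xdLow_eq : xdLow = lowList := rfl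

/-! ## Direction summands of `FTW`, `Bd` -/

/-- the `FTW` direction summand (the lambda of `FTWfun`). -/
noncomputable def ftwTerm (L : ℕ) [NeZero L] (f : Tor L → ℝ) (k₂ k₃ e : Tor L) : ℂ :=
  (starRingEnd ℂ) (phase L k₂ e) * ((1 + phase L (K1 L) e) * Yfun L f e k₃ + Yfun L f e (k₃ - K1 L))
    + (starRingEnd ℂ) (phase L k₃ e) * ((1 + phase L (K1 L) e) * Yfun L f e k₂ + Yfun L f e (k₂ - K1 L))
    + (starRingEnd ℂ) (phase L k₃ e) * (Yfun L f (-e) (k₂ + k₃) + (1 + phase L (K1 L) e) * Yfun L f (-e) (k₂ + k₃ - K1 L))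

/-- the `Bd` direction summand (the lambda of `Bdfun`). -/
noncomputable def bdTerm (L : ℕ) [NeZero L] (f : Tor L → ℝ) (k₂ k₃ e : Tor L) : ℂ :=
  (1 + phase L (K1 L) e) * (Yfun L f e k₂ + Yfun L f e k₃) + Yfun L f e (k₂ - K1 L) + Yfun L f e (k₃ - K1 L)
    + Yfun L f (-e) (k₂ + k₃) + (1 + phase L (K1 L) e) * Yfun L f (-e) (k₂ + k₃ - K1 L)

/-! ## GM₃ cells -/

/-- a GM₃ cell point: the row-D/side cell starts at `lam` with constant `aD`; its `N₁`/row-C constants `(c, bn)` are certified on the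
enclosing combined cell `[la, lb]`. -/
structure GCell where
  /-- `λ·D` of the point -/
  lam : ℤ
  /-- row-D constant -/
  aD : ℚ
  /-- row-`N₁` constant -/
  c : ℚ
  /-- row-C numerator (`b = bn/bd`) -/
  bn : ℕ
  /-- enclosing combined cell, lower end -/
  la : ℤ
  /-- enclosing combined cell, upper end -/
  lb : ℤ
  deriving DecidableEq

/-- the per-pair check: row D, side condition, nesting, and the enclosing combined `N₁`+C cell. -/
def gmCellOK (L : ℕ) (d1 : ℚ) (bd : ℕ) (a : GCell) (next : ℤ) : Bool :=
  xdCellAny0 L d1 a.lam next a.aD && sdCellAnyZ L d1 bd a.lam next (a.c, a.bn, a.aD) &&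
    decide (a.la ≤ a.lam) && decide (next ≤ a.lb) && xbcCellAny L d1 bd a.la a.lb (a.c, a.bn)

/-- all consecutive pairs pass. -/
def cellsAllG (L : ℕ) (d1 : ℚ) (bd : ℕ) : List GCell → Bool
  | [] => true
  | [_] => true
  | a :: b :: rest => gmCellOK L d1 bd a b.lam && cellsAllG L d1 bd (b :: rest)

/-- the last point. -/
def cellsLastG : List GCell → ℤ
  | [] => 0
  | [a] => a.lam
  | _ :: b :: rest => cellsLastG (b :: rest)

/-- ★ THE PER-`L` GM₃ CERTIFICATE on `0 < Δ ≤ Δ₁`: points start at `0`, end `≥ lamTop L`, `0 < bd`, every pair passes. -/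
def gmCheck (L : ℕ) (d1 : ℚ) (bd : ℕ) (cells : List GCell) : Bool :=
  decide ((cells.head?.map GCell.lam) = some 0) && decide (2 ≤ cells.length) && decide (lamTop L ≤ cellsLastG cells)
    && decide (0 < bd) && cellsAllG L d1 bd cells

end FinXD

end Summit.HubbardSuperconductivity.HubbardSuperconductivity.Theorems.AnisotropyChord.Transfer.Fibre3
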